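import Mathlib.RepresentationTheory.Irreducible
import Mathlib.RepresentationTheory.Subrepresentation
import Mathlib.LinearAlgebra.Dimension.Finrank
import Mathlib.LinearAlgebra.FiniteDimensional.Defs
import HarnessLib

/-!
# Schur's bound `dim Hom_G(ρ, σ) ≤ 1` for irreducible representations, and irreducibility of a stable subspace from its lattice of stable subspaces

Topic `RepresentationTheory`; namespace `Literature.RepresentationTheory`; THEOREMS ONLY (no `def`, no named fact, no instance, no notation, no `sorry`);
Mathlib only.
Cell `hodgecm-mathlib`, F0∕P3, T1a arch line: the `F 0 = W₀` term of the N3 socket `LevelBound₂₁` of the V19 pay-down line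
(`Cruxes/H413/Lines/F0_T1a_V19KTypeGrowthPaydown.lean`, desk F0P3b-plan (g10)): `dim Hom_K(τ, W₀) ≤ 1` for irreducible `τ` and the irreducible `K`-type `W₀`.

THE STATEMENTS ([Bump1997, Thm. 3.4.1]; [KnappVogan1995, §I.3]).
* `isIrreducible_toRepresentation_of_forall_stable` — a stable subspace `P ≠ 0` of a representation `R` on `X` whose only `R`-stable subspaces are `0` and `P`
  carries an IRREDUCIBLE subrepresentation `P.toRepresentation` (Mathlib `Representation.IsIrreducible` = simplicity of the lattice of subrepresentations);
* **`finrank_intertwiningMap_le_one`** — `dim_k Hom_G(ρ, σ) ≤ 1` for irreducible `ρ`, `σ` with `ρ` finite-dimensional over an algebraically closed `k`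
  (if an equivalence `e` exists, `f ↦ e⁻¹ ∘ f` embeds `Hom_G(ρ, σ)` into `Hom_G(ρ, ρ)`, of dimension `1` by Mathlib `finrank_intertwiningMap_self`; otherwise
  `Hom = 0`, Mathlib's `Subsingleton` instance from Schur's dichotomy);
* `finrank_intertwiningMap_toRepresentation_le_one` — the two combined: `dim Hom_G(τ, P.toRepresentation) ≤ 1`.
HONEST LABEL: closes no registered stub by itself.  HC_CM is proved only modulo the 2 remaining named inputs (hLiu418, h413) until rung 0 closes.

## References
* D. Bump, *Automorphic Forms and Representations* (1997), Thm. 3.4.1 (Schur's lemma) [Bump1997].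
* A. W. Knapp, D. A. Vogan, *Cohomological Induction and Unitary Representations* (1995), §I.3 [KnappVogan1995].
-/

set_option autoImplicit false

noncomputable section

namespace Literature.RepresentationTheory

universe u v w w'

variable {k : Type u} [Field k] {G : Type v} [Monoid G]

/-! ## §1 Irreducibility of `P.toRepresentation` from the stable subspaces of `P` -/

section Stable

variable {X : Type w} [AddCommGroup X] [Module k X] {R : Representation k G X}

/-- A subrepresentation of `P.toRepresentation`, pushed into `X`, is an `R`-stable subspace of `P`. [cite: Bump1997, Theorem 3.4.1] -/
theorem map_subtype_stable (P : Subrepresentation R) (Q : Subrepresentation P.toRepresentation) (g : G) {x : X}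
    (hx : x ∈ Q.toSubmodule.map P.toSubmodule.subtype) : R g x ∈ Q.toSubmodule.map P.toSubmodule.subtype := by
  obtain ⟨y, hy, rfl⟩ := hx
  exact ⟨P.toRepresentation g y, Q.apply_mem_toSubmodule g hy, rfl⟩

/-- **Irreducibility from the lattice of stable subspaces**: if `P ≠ 0` and every `R`-stable subspace `U ≤ P` is `0` or `P`, then `P.toRepresentation` is
irreducible. [cite: Bump1997, Theorem 3.4.1] [cite: KnappVogan1995, §I.3] -/
theorem isIrreducible_toRepresentation_of_forall_stable (P : Subrepresentation R) (hne : P.toSubmodule ≠ ⊥)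
    (h : ∀ U : Submodule k X, U ≤ P.toSubmodule → (∀ g : G, ∀ u ∈ U, R g u ∈ U) → U = ⊥ ∨ U = P.toSubmodule) :
    P.toRepresentation.IsIrreducible := by
  have hinj : Function.Injective (Submodule.map P.toSubmodule.subtype : Submodule k P.toSubmodule → Submodule k X) :=
    Submodule.map_injective_of_injective P.toSubmodule.injective_subtype
  -- `⊥ ≠ ⊤` in the lattice of subrepresentations of `P.toRepresentation`
  haveI : Nontrivial (Subrepresentation P.toRepresentation) := by
    refine ⟨⟨⊥, ⊤, fun hbt => hne ?_⟩⟩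
    have h1 : (⊥ : Submodule k P.toSubmodule).map P.toSubmodule.subtype = (⊤ : Submodule k P.toSubmodule).map P.toSubmodule.subtype :=
      congrArg (fun Q : Subrepresentation P.toRepresentation => Q.toSubmodule.map P.toSubmodule.subtype) hbt
    rw [Submodule.map_bot, Submodule.map_subtype_top] at h1
    exact h1.symm
  refine ⟨fun Q => ?_⟩
  have hQ := h (Q.toSubmodule.map P.toSubmodule.subtype) (Submodule.map_subtype_le _ _) (fun g u hu => map_subtype_stable P Q g hu)
  rcases hQ with hQ | hQ
  · left
    apply Subrepresentation.toSubmodule_injective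
    apply hinj
    change Q.toSubmodule.map P.toSubmodule.subtype = (⊥ : Submodule k P.toSubmodule).map P.toSubmodule.subtype
    rw [hQ, Submodule.map_bot]
  · right
    apply Subrepresentation.toSubmodule_injective
    apply hinj
    change Q.toSubmodule.map P.toSubmodule.subtype = (⊤ : Submodule k P.toSubmodule).map P.toSubmodule.subtype
    rw [hQ, Submodule.map_subtype_top]

end Stable

/-! ## §2 Schur's bound `dim Hom_G(ρ, σ) ≤ 1` -/

section Schur

variable {V : Type w} [AddCommGroup V] [Module k V] {W : Type w'} [AddCommGroup W] [Module k W]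

/-- **SCHUR'S BOUND: `dim_k Hom_G(ρ, σ) ≤ 1`** for irreducible `ρ`, `σ`, `ρ` finite-dimensional, `k` algebraically closed (equivalent ⇒ `Hom_G(ρ, σ) ↪ End_G(ρ) = k`,
Mathlib `finrank_intertwiningMap_self`; inequivalent ⇒ `Hom = 0` by Schur's dichotomy). [cite: Bump1997, Theorem 3.4.1] [cite: KnappVogan1995, §I.3] -/
theorem finrank_intertwiningMap_le_one [IsAlgClosed k] [FiniteDimensional k V] (ρ : Representation k G V) (σ : Representation k G W)
    [ρ.IsIrreducible] [σ.IsIrreducible] : Module.finrank k (Representation.IntertwiningMap ρ σ) ≤ 1 := by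
  by_cases h : Nonempty (Representation.Equiv ρ σ)
  · obtain ⟨e⟩ := h
    -- `f ↦ e⁻¹ ∘ f : Hom(ρ, σ) → Hom(ρ, ρ)` is injective and linear
    let L : Representation.IntertwiningMap ρ σ →ₗ[k] Representation.IntertwiningMap ρ ρ :=
      Representation.IntertwiningMap.llcomp ρ σ ρ e.symm.toIntertwiningMap
    have hL : Function.Injective L := by
      intro f f' hff'
      apply Representation.IntertwiningMap.ext
      apply LinearMap.ext
      intro v
      have h1 : L f v = L f' v := by rw [hff']
      change e.toLinearEquiv.symm (f v) = e.toLinearEquiv.symm (f' v) at h1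
      change f v = f' v
      exact e.toLinearEquiv.symm.injective h1
    calc Module.finrank k (Representation.IntertwiningMap ρ σ)
        ≤ Module.finrank k (Representation.IntertwiningMap ρ ρ) := LinearMap.finrank_le_finrank_of_injective hL
      _ = 1 := Representation.IsIrreducible.finrank_intertwiningMap_self ρ
      _ ≤ 1 := le_rfl
  · haveI : IsEmpty (Representation.Equiv ρ σ) := not_nonempty_iff.mp h
    haveI : Subsingleton (Representation.IntertwiningMap ρ σ) := inferInstance
    rw [Module.finrank_zero_of_subsingleton]
    exact zero_le_one

end Schur

/-! ## §3 Combined: `dim Hom_G(τ, P.toRepresentation) ≤ 1` for an irreducible stable `P` -/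

section Combined

variable {X : Type w} [AddCommGroup X] [Module k X] {R : Representation k G X} {V : Type w'} [AddCommGroup V] [Module k V]

/-- **`dim Hom_G(τ, P) ≤ 1`** for `τ` irreducible finite-dimensional (`k` algebraically closed) and `P ≠ 0` a stable subspace whose only stable subspaces are
`0` and `P` — the `F 0 = W₀` term of the V19 line's `LevelBound₂₁`. [cite: Bump1997, Theorem 3.4.1] [cite: KnappVogan1995, §I.3] -/
theorem finrank_intertwiningMap_toRepresentation_le_one [IsAlgClosed k] [FiniteDimensional k V] (τ : Representation k G V) [τ.IsIrreducible]
    (P : Subrepresentation R) (hne : P.toSubmodule ≠ ⊥)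
    (h : ∀ U : Submodule k X, U ≤ P.toSubmodule → (∀ g : G, ∀ u ∈ U, R g u ∈ U) → U = ⊥ ∨ U = P.toSubmodule) :
    Module.finrank k (Representation.IntertwiningMap τ P.toRepresentation) ≤ 1 := by
  haveI := isIrreducible_toRepresentation_of_forall_stable P hne h
  exact finrank_intertwiningMap_le_one τ P.toRepresentation

end Combined

end Literature.RepresentationTheory

end
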